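import Literature.IUT.HodgeArakelov.LabelClassesOfCuspsCardGenuineLevelV
import HarnessLib

/-!
# [IUTchII] Def 2.3 (ii) at the genuine tower: the tempered `(A)`-characterisation of the cusps of `Π^±_v` is `ι(inclX Π^tp_X)`-HOMOGENEOUS

S. Mochizuki, *Inter-universal Teichmüller theory II*, kurims manuscript (Dec. 2020), §2 Def 2.3 (ii) p. 68, Rmk 2.3.1 p. 69 («the cuspidal inertia
groups … are permuted by the conjugation action of `Π^cor_v`») [claim: Mochizuki2012, status: disputed] (IUTchII §2 Def 2.3 (ii), kurims p.68)
(D-0012 claim key; record-only); [EtTh] Def 2.1 p. 36 (the inversion of `C = X/±1`) [cite: MochizukiEtTh2009, Def 2.1 p.36]; [SemiAnbd] Thm 6.5 (iii)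
p. 72 [cite: MochizukiSemiAnbd2006, Thm 6.5(iii) p.72].

abc-iut cell, seat abc-iut-w5-d132 (gen 6), row «DEF23iii-CARD-V» part 3 (companion of `LabelClassesOfCuspsCardGenuineLevelV`).  PROOF-ONLY (no `def`,
no instance, no new named fact).  The hypothesis `hCuPM` of the `Π_v`-level count («the cusps of `Π^±_v` are the `ι(inclX Π^tp_X)`-conjugates of
`J₀ = ι(inclX I_{x₀})`») DERIVED for every cuspidal datum with abc-iut-w5-d132's p430433 `(A)`-characterisation (cusps of `Π_□` = «`J ≤ Π_□`, `J` a
`Π^±_v`-conjugate of `ι((g·inclX I_x·g⁻¹) ∩ inclX Π^tp_{X̲})`, `g ∈ Π^tp_C`»): `exists_mem_range_conj_eq` (an inversion `g₀ ∈ Π^tp_C ∖ Π^tp_X` fixing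
the cusp — abc-iut-L2's `exists_not_mem_range_mem_normalizer_decomp`, [SemiAnbd] Thm 6.5 (iii) F-1674 BY NAME + «unique cusp» — normalises `inclX I_{x₀}`,
so `ι(Π^tp_C)`-conjugates of `J₀` are `ι(inclX Π^tp_X)`-conjugates), **`isCuspidalInertia_piPM_iff_rangeX`**.

HONEST LABEL: theorems about the kernel's genuine tower over abc-iut-L2's [EtTh] interface data modulo `op`, «unique cusp», F-1674, L02 `hZ`, `hN`;
nothing of the series is asserted; no side taken on [IUTchIII] Cor 3.12; typed ≠ proved.
-/

noncomputable section

namespace Literature.IUT.HodgeArakelov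

open Literature.AnabelianGeometry Literature.AnabelianGeometry.EtaleTheta Literature.AnabelianGeometry.SemiGraphs
open scoped Pointwise

/-- Pushing a conjugate forward: `f(a H a⁻¹) = f(a) f(H) f(a)⁻¹`. [folklore] -/
private theorem map_conj_smul₃ {A B : Type*} [Group A] [Group B] (f : A →* B) (a : A) (H : Subgroup A) :
    (MulAut.conj a • H).map f = MulAut.conj (f a) • H.map f := by
  rw [conj_smul_eq_map_conj, conj_smul_eq_map_conj, Subgroup.map_map, Subgroup.map_map]
  congr 1
  ext x
  simp [MulAut.conj_apply]

namespace PlusMinusTower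

variable {p : ℕ} [Fact p.Prime] {M : MuTwoSetting p} (e : M.CLevelData)
  {E : M.toThetaSetting.EtaleThetaData} {l : ℕ} (C : E.DoubleUnderline l) {N : ℕ+}
  (μ : M.toThetaSetting.CyclotomeMod l N) (hC : M.toThetaSetting.Compat) (hS : M.toThetaSetting.Sec2Hyps)
  (hl : l.Prime) (hp2 : p ≠ 2) (hpl : p ≠ l) (hζ : ∃ ζ : M.toThetaSetting.K, IsPrimitiveRoot ζ (4 * l))
  {η : (C.thetaEnvData μ hC hS).PiYdd → MuN p N} (hη : η ∈ (C.thetaEnvData μ hC hS).thetaCocycles)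
  {Q : Type} [Group Q] [TopologicalSpace Q] [IsTopologicalGroup Q]
  (ι : M.GtpC →ₜ* Q) (hι : IsProfiniteCompletion ι) (hinj : Function.Injective ι)
  (Φ : Q →* GQp p) (hΦ : ∀ g : M.GtpC, Φ (ι g) = e.augC g) (hΦK : Φ.range = M.GK)
  (hZ : Thm16Sub.KerToZIsCompactlyGenerated M.toThetaSetting) (hN : (C.Huu.subgroupOf (M.GtpXu l)).Normal)
  {P : TopGroup.{0}} (T : TemperedCoverings (BadPlaceSetting.ofUnderline C μ hC hS hl hp2 hpl hζ hη) P) {x₀ : M.Pt}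

/-! ## The `(A)`-characterisation at level `Π^±_v` gives `ι(inclX Π^tp_X)`-homogeneity -/

section RangeX

include e in
omit [IsTopologicalGroup Q] in
/-- An inversion `g₀ ∈ Π^tp_C ∖ Π^tp_X` normalising `inclX D_{x₀}` also normalises `inclX I_{x₀}` (`I_{x₀} = D_{x₀} ∩ Ker aug`, `Ker augC ⊴ Π^tp_C`); hence EVERY
`ι(Π^tp_C)`-conjugate of `J₀ = ι(inclX I_{x₀})` is an `ι(inclX Π^tp_X)`-conjugate (`[Π^tp_C : Π^tp_X] = 2`). [cite: MochizukiEtTh2009, Def 2.1 p.36] -/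
theorem exists_mem_range_conj_eq (hx₀ : M.IsCusp x₀) (huniq : ∀ x' : M.Pt, M.IsCusp x' → x' = x₀)
    (h65iii : M.toTemperedCurve.IsoPreservesCuspidalDecomp M.toTemperedCurve) (c : M.GtpC) :
    ∃ c' ∈ M.inclX.range,
      MulAut.conj (ι c) • (((M.toTemperedCurve.inertia x₀).map M.inclX).map ι.toMonoidHom : Subgroup Q) =
        MulAut.conj (ι c') • ((M.toTemperedCurve.inertia x₀).map M.inclX).map ι.toMonoidHom := by
  by_cases hc : c ∈ M.inclX.range
  · exact ⟨c, hc, rfl⟩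
  obtain ⟨g₀, hg₀X, hg₀N⟩ := e.exists_not_mem_range_mem_normalizer_decomp hx₀ huniq h65iii
  -- `g₀` normalises `inclX I_{x₀} = inclX D_{x₀} ∩ Ker augC`
  have hID : (M.toTemperedCurve.inertia x₀).map M.inclX = (M.decomp x₀).map M.inclX ⊓ e.augC.toMonoidHom.ker := by
    apply le_antisymm
    · rintro z ⟨d, hd, rfl⟩
      have hd' : d ∈ M.decomp x₀ ⊓ M.toTemperedCurve.DeltaTemp := hd
      refine ⟨⟨d, hd'.1, rfl⟩, ?_⟩
      change e.augC (M.inclX d) = 1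
      rw [e.augC_inclX]; exact hd'.2
    · rintro z ⟨⟨d, hd, rfl⟩, hz⟩
      change e.augC (M.inclX d) = 1 at hz
      rw [e.augC_inclX] at hz
      exact ⟨d, ⟨hd, hz⟩, rfl⟩
  have hg₀I : MulAut.conj g₀ • (M.toTemperedCurve.inertia x₀).map M.inclX = (M.toTemperedCurve.inertia x₀).map M.inclX := by
    rw [hID, Subgroup.smul_inf, mem_normalizer_iff_conj_smul_eq.mp hg₀N, Subgroup.Normal.conj_smul_eq_self]
  -- `c = (c g₀⁻¹) g₀` with `c g₀⁻¹ ∈ inclX(Π^tp_X)`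
  have hmem : c * g₀⁻¹ ∈ M.inclX.range := by
    rw [Subgroup.mul_mem_iff_of_index_two M.index_range_inclX, Subgroup.inv_mem_iff]
    exact ⟨fun h => absurd h hc, fun h => absurd h hg₀X⟩
  refine ⟨c * g₀⁻¹, hmem, ?_⟩
  have hc' : ι c = ι (c * g₀⁻¹) * ι g₀ := by rw [← map_mul, inv_mul_cancel_right]
  have h3 : MulAut.conj (ι g₀) • (((M.toTemperedCurve.inertia x₀).map M.inclX).map ι.toMonoidHom : Subgroup Q) =
      ((M.toTemperedCurve.inertia x₀).map M.inclX).map ι.toMonoidHom := by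
    have h := map_conj_smul₃ ι.toMonoidHom g₀ ((M.toTemperedCurve.inertia x₀).map M.inclX)
    rw [hg₀I] at h
    exact h.symm
  rw [hc', map_mul, mul_smul, h3]

/-- **The p430433 `(A)`-characterisation at level `Π^±_v` ⇒ `ι(inclX Π^tp_X)`-homogeneity (`hCuPM`)**: for a datum with cusps at `Π^±_v` «`J ≤ Π^±_v` and
`J = t · ι((g·inclX I_x·g⁻¹) ∩ inclX Π^tp_{X̲}) · t⁻¹`, `t ∈ Π^±_v`», the cusps of `Π^±_v` are exactly the `ι(inclX Π^tp_X)`-conjugates of `J₀` (one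
cusp `x₀`; the inversion of `C = X/±1` fixes the cusp — [SemiAnbd] Thm 6.5 (iii) F-1674 BY NAME).
([IUTchII] Def 2.3 (ii), Rmk 2.3.1, kurims pp.68–69) [claim: Mochizuki2012, status: disputed] -/
theorem isCuspidalInertia_piPM_iff_rangeX (op : M.toThetaSetting.OncePuncturedData) (hx₀ : M.IsCusp x₀)
    (huniq : ∀ x' : M.Pt, M.IsCusp x' → x' = x₀) (h65iii : M.toTemperedCurve.IsoPreservesCuspidalDecomp M.toTemperedCurve)
    (Cu : CuspidalInertiaData (ofCoverModel e C μ hC hS hl hp2 hpl hζ hη ι hι hinj Φ hΦ hΦK hZ hN T))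
    (hCuA : ∀ Q' J : Subgroup (ofCoverModel e C μ hC hS hl hp2 hpl hζ hη ι hι hinj Φ hΦ hΦK hZ hN T).Corhat,
      Cu.IsCuspidalInertia Q' J ↔ J ≤ Q' ∧ ∃ i : {x : M.Pt // M.IsCusp x} × M.GtpC,
        ∃ t ∈ (ofCoverModel e C μ hC hS hl hp2 hpl hζ hη ι hι hinj Φ hΦ hΦK hZ hN T).piPM,
          J = MulAut.conj t •
            (((MulAut.conj i.2 • (M.toTemperedCurve.inertia i.1.1).map M.inclX) ⊓ (M.GtpXu l).map M.inclX).map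
              ι.toMonoidHom : Subgroup (ofCoverModel e C μ hC hS hl hp2 hpl hζ hη ι hι hinj Φ hΦ hΦK hZ hN T).Corhat))
    (I : Subgroup (ofCoverModel e C μ hC hS hl hp2 hpl hζ hη ι hι hinj Φ hΦ hΦK hZ hN T).Corhat) :
    Cu.IsCuspidalInertia (ofCoverModel e C μ hC hS hl hp2 hpl hζ hη ι hι hinj Φ hΦ hΦK hZ hN T).piPM I ↔
      ∃ r ∈ (M.inclX.range.map ι.toMonoidHom : Subgroup (ofCoverModel e C μ hC hS hl hp2 hpl hζ hη ι hι hinj Φ hΦ hΦK hZ hN T).Corhat),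
        I = MulAut.conj r • (((M.toTemperedCurve.inertia x₀).map M.inclX).map ι.toMonoidHom :
          Subgroup (ofCoverModel e C μ hC hS hl hp2 hpl hζ hη ι hι hinj Φ hΦ hΦK hZ hN T).Corhat) := by
  let ιW : M.GtpC →* (ofCoverModel e C μ hC hS hl hp2 hpl hζ hη ι hι hinj Φ hΦ hΦK hZ hN T).Corhat := ι.toMonoidHom
  have hPM : (ofCoverModel e C μ hC hS hl hp2 hpl hζ hη ι hι hinj Φ hΦ hΦK hZ hN T).piPM = ((M.GtpXu l).map M.inclX).map ιW :=
    piPM_ofCoverModel e C μ hC hS hl hp2 hpl hζ hη ι hι hinj Φ hΦ hΦK hZ hN T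
  have hfam : ∀ i : {x : M.Pt // M.IsCusp x} × M.GtpC,
      ((((MulAut.conj i.2 • (M.toTemperedCurve.inertia i.1.1).map M.inclX) ⊓ (M.GtpXu l).map M.inclX).map ιW :
        Subgroup (ofCoverModel e C μ hC hS hl hp2 hpl hζ hη ι hι hinj Φ hΦ hΦK hZ hN T).Corhat)) =
        MulAut.conj (ιW i.2) • (((M.toTemperedCurve.inertia x₀).map M.inclX).map ιW :
          Subgroup (ofCoverModel e C μ hC hS hl hp2 hpl hζ hη ι hι hinj Φ hΦ hΦK hZ hN T).Corhat) := by
    rintro ⟨⟨x, hx⟩, g⟩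
    obtain rfl := huniq x hx
    exact cuspFamily_eq_conj e ι hZ op hx g
  have hQR : (ofCoverModel e C μ hC hS hl hp2 hpl hζ hη ι hι hinj Φ hΦ hΦK hZ hN T).piPM ≤
      (M.inclX.range.map ιW : Subgroup (ofCoverModel e C μ hC hS hl hp2 hpl hζ hη ι hι hinj Φ hΦ hΦK hZ hN T).Corhat) := by
    rw [hPM]; exact Subgroup.map_mono (Subgroup.map_le_range _ _)
  have hRQ : ∀ r ∈ (M.inclX.range.map ιW : Subgroup (ofCoverModel e C μ hC hS hl hp2 hpl hζ hη ι hι hinj Φ hΦ hΦK hZ hN T).Corhat),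
      MulAut.conj r • (ofCoverModel e C μ hC hS hl hp2 hpl hζ hη ι hι hinj Φ hΦ hΦK hZ hN T).piPM =
        (ofCoverModel e C μ hC hS hl hp2 hpl hζ hη ι hι hinj Φ hΦ hΦK hZ hN T).piPM := by
    intro r hr
    rw [hPM]
    exact conj_smul_map_GtpXu_of_mem_rangeX ι hr
  -- `J₀ ≤ Π^±_v`
  have hJ₀PM : (((M.toTemperedCurve.inertia x₀).map M.inclX).map ιW :
      Subgroup (ofCoverModel e C μ hC hS hl hp2 hpl hζ hη ι hι hinj Φ hΦ hΦK hZ hN T).Corhat) ≤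
        (ofCoverModel e C μ hC hS hl hp2 hpl hζ hη ι hι hinj Φ hΦ hΦK hZ hN T).piPM := by
    rw [hPM]; exact Subgroup.map_mono (Subgroup.map_mono (inertia_le_GtpXu op hx₀))
  rw [hCuA]
  constructor
  · rintro ⟨-, i, t, ht, rfl⟩
    obtain ⟨c', hc', hreq⟩ := exists_mem_range_conj_eq e ι hx₀ huniq h65iii i.2
    have hreq' : MulAut.conj (ιW i.2) • (((M.toTemperedCurve.inertia x₀).map M.inclX).map ιW :
        Subgroup (ofCoverModel e C μ hC hS hl hp2 hpl hζ hη ι hι hinj Φ hΦ hΦK hZ hN T).Corhat) =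
          MulAut.conj (ιW c') • ((M.toTemperedCurve.inertia x₀).map M.inclX).map ιW := hreq
    refine ⟨t * ιW c', Subgroup.mul_mem _ (hQR ht) ⟨c', hc', rfl⟩, ?_⟩
    rw [hfam i, hreq', map_mul, mul_smul]
  · rintro ⟨r, hr, rfl⟩
    obtain ⟨w, ⟨y, rfl⟩, rfl⟩ := hr
    refine ⟨(Subgroup.pointwise_smul_le_pointwise_smul_iff.mpr hJ₀PM).trans_eq (hRQ _ ⟨M.inclX y, ⟨y, rfl⟩, rfl⟩),
      ⟨⟨x₀, hx₀⟩, M.inclX y⟩, 1, Subgroup.one_mem _, ?_⟩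
    rw [hfam, map_one, one_smul]

end RangeX

end PlusMinusTower

end Literature.IUT.HodgeArakelov

end
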